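import Mathlib
import HarnessLib
import Literature.NumberTheory.DiophantineGeometry.RothPrelim
import Literature.NumberTheory.DiophantineGeometry.RothTaylor

/-!
# The Subspace Theorem over `ℚ` — V. Linear substitutions and Hasse derivatives (B–G 7.5.14)

Fifth file towards the `p`-adic Subspace Theorem over `ℚ` (Bombieri–Gubler §7.5 specialised to
`K = ℚ`). B–G 7.5.14 work with multihomogeneous polynomials `P(x_1, …, x_m)` in `m` blocks of
`n + 1` variables, the normalised derivatives `∂_I = (1/I!) ∂^I` and the expansion coefficients
`a(L; J; I)` of `∂_I P` with respect to the monomials `L(x_1)^{j_1} ⋯ L(x_m)^{j_m}` in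
independent linear forms `L`. This file supplies the algebra behind these manipulations, for
polynomials over any commutative ring and any (finite) sets of variables:

* `linSubst c` — the substitution of variables by linear forms `X_s ↦ Σ_t c_{s t} X_t`
  (an algebra homomorphism `R[X_σ] → R[X_τ]`), its values (`aeval_linSubst`), composition
  (`linSubst_linSubst` = matrix product) and identity;
* `hasseD_linSubst` — **the chain rule** for Schmidt's/B–G's operators `∂_I` (the tree's
  `Roth.hasseD`) under a linear substitution:
  `∂_I (P ∘ c) = Σ_{I'} (∂_{I'} P ∘ c) · γ_c(I', I)`, `γ_c(I', I)` the coefficient of `X^I` in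
  `∏_s (Σ_t c_{st} X_t)^{I'_s}`; proved from the functoriality of the universal Taylor expansion
  `P(X + Y)` (`Taylor.shift` of the tree) — B–G use it tacitly in 7.5.15 ("looking at
  `(∂_I P)(M_v(x))`"), 7.5.22 and 7.5.23 ("`∂_J R` is a linear combination of derivatives
  `∂_{I'} P`");
* `substCoeff_eq_zero_of_weight_ne` — `γ_c(I', I) = 0` unless `I` and `I'` have the same weight,
  for a weight-preserving `c` (so block-diagonal substitutions preserve block degrees);
* `IsWeightedHomogeneous.linSubst`, `isWeightedHomogeneous_hasseD` — multihomogeneity (as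
  Mathlib's weighted homogeneity for the block weight) is preserved by block substitutions and
  shifted by `∂_I`.

## References
* [BombieriGubler2006] E. Bombieri, W. Gubler, *Heights in Diophantine Geometry*, CUP 2006,
  7.5.14 (the operators `∂_I`, the coefficients `a(L; J; I)`), 7.5.22–7.5.23.
* [Schmidt1980] W. M. Schmidt, *Diophantine Approximation*, LNM 785, Ch. V §5 (the `P_i`).
-/

noncomputable section

open MvPolynomial Finset

namespace Literature.NumberTheory.DiophantineApproximation.Subspace

open Literature.NumberTheory.DiophantineGeometry Literature.NumberTheory.DiophantineGeometry.Roth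
open Literature.NumberTheory.Transcendental

variable {σ τ υ : Type*} {R : Type*} [CommRing R]

/-! ### Linear substitutions -/

section LinSubst

variable [Fintype τ]

/-- The substitution of variables by linear forms: `X_s ↦ Σ_t c_{s t} X_t`.
[cite: BombieriGubler2006, 7.5.14] -/
def linSubst (c : σ → τ → R) : MvPolynomial σ R →ₐ[R] MvPolynomial τ R :=
  aeval fun s => ∑ t, C (c s t) * X t

/-- `linSubst` on a variable. [folklore] -/
@[simp] theorem linSubst_X (c : σ → τ → R) (s : σ) :
    linSubst c (X s) = ∑ t, C (c s t) * X t := by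
  simp [linSubst]

/-- `linSubst` on a constant. [folklore] -/
@[simp] theorem linSubst_C (c : σ → τ → R) (r : R) : linSubst c (C r : MvPolynomial σ R) = C r := by
  simp [linSubst]

/-- `linSubst` on a monomial: `X^k ↦ ∏_s (Σ_t c_{st} X_t)^{k_s}` (times the coefficient).
[folklore] -/
theorem linSubst_monomial [Fintype σ] (c : σ → τ → R) (k : σ →₀ ℕ) (r : R) :
    linSubst c (monomial k r) = C r * ∏ s, (∑ t, C (c s t) * X t) ^ (k s) := by
  rw [linSubst, aeval_monomial, algebraMap_eq, Finsupp.prod_fintype _ _ (fun s => pow_zero _)]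

/-- Values of a substituted polynomial: `(P ∘ c)(x) = P((Σ_t c_{st} x_t)_s)`. [folklore] -/
theorem aeval_linSubst {A : Type*} [CommRing A] [Algebra R A] (c : σ → τ → R) (x : τ → A)
    (P : MvPolynomial σ R) :
    aeval x (linSubst c P) = aeval (fun s => ∑ t, c s t • x t) P := by
  rw [linSubst, ← AlgHom.comp_apply]
  congr 1
  refine MvPolynomial.algHom_ext fun s => ?_
  simp [Algebra.smul_def]

/-- Composition of linear substitutions is the substitution by the product matrix. [folklore] -/
theorem linSubst_linSubst [Fintype υ] (c : σ → τ → R) (c' : τ → υ → R) (P : MvPolynomial σ R) :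
    linSubst c' (linSubst c P) = linSubst (fun s u => ∑ t, c s t * c' t u) P := by
  rw [linSubst, linSubst, linSubst, ← AlgHom.comp_apply]
  congr 1
  refine MvPolynomial.algHom_ext fun s => ?_
  simp only [AlgHom.comp_apply, aeval_X, map_sum, map_mul, aeval_C, algebraMap_eq]
  simp_rw [Finset.mul_sum]
  rw [Finset.sum_comm]
  refine Finset.sum_congr rfl fun u _ => ?_
  rw [Finset.sum_mul]
  refine Finset.sum_congr rfl fun t _ => ?_
  ring

end LinSubst

/-- The identity substitution. [folklore] -/
theorem linSubst_one [Fintype σ] [DecidableEq σ] (P : MvPolynomial σ R) :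
    linSubst (fun s t : σ => if s = t then (1 : R) else 0) P = P := by
  conv_rhs => rw [← aeval_X_left_apply (R := R) P]
  rw [linSubst]
  refine congrArg (fun f : σ → MvPolynomial σ R => aeval f P) ?_
  funext s
  simp [apply_ite C, Finset.sum_ite_eq]

/-! ### The chain rule for `∂_I` under linear substitutions -/

section ChainRule

variable [Fintype σ] [Fintype τ]

/-- The coefficient `γ_c(I', I)` of `X^I` in `∏_s (Σ_t c_{st} X_t)^{I'_s}`.
[cite: BombieriGubler2006, 7.5.14] -/
def substCoeff (c : σ → τ → R) (I' : σ →₀ ℕ) (I : τ →₀ ℕ) : R :=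
  coeff I (∏ s, (∑ t, C (c s t) * X t : MvPolynomial τ R) ^ (I' s))

/-- Unfolding lemma for `substCoeff`. [folklore] -/
theorem substCoeff_def (c : σ → τ → R) (I' : σ →₀ ℕ) (I : τ →₀ ℕ) :
    substCoeff c I' I = coeff I (∏ s, (∑ t, C (c s t) * X t : MvPolynomial τ R) ^ (I' s)) := rfl

/-- The double substitution `Ψ_c : R[X][Y] → R[X'][Y']`, `X_s ↦ Σ c_{st} X'_t`,
`Y_s ↦ Σ c_{st} Y'_t`. [folklore] -/
def shiftSubst (c : σ → τ → R) :
    MvPolynomial σ (MvPolynomial σ R) →+* MvPolynomial τ (MvPolynomial τ R) :=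
  eval₂Hom (C.comp (linSubst c : MvPolynomial σ R →ₐ[R] MvPolynomial τ R).toRingHom)
    fun s => ∑ t, C (C (c s t)) * X t

omit [Fintype σ] in
/-- **Functoriality of the Taylor shift**: `Ψ_c (P(X + Y)) = (P ∘ c)(X' + Y')`. [folklore] -/
theorem shiftSubst_shift (c : σ → τ → R) (P : MvPolynomial σ R) :
    shiftSubst c (Taylor.shift P) = Taylor.shift (linSubst c P) := by
  have key : (shiftSubst c).comp (Taylor.shift : MvPolynomial σ R →ₐ[R] _).toRingHom =
      (Taylor.shift : MvPolynomial τ R →ₐ[R] _).toRingHom.comp (linSubst c).toRingHom := by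
    apply ringHom_ext
    · intro r
      simp [shiftSubst]
    · intro s
      simp only [RingHom.coe_comp, Function.comp_apply, AlgHom.toRingHom_eq_coe,
        AlgHom.coe_toRingHom, Taylor.shift_X, linSubst_X, map_sum, map_mul, Taylor.shift_C]
      simp only [shiftSubst, map_add, coe_eval₂Hom, eval₂_C, eval₂_X, RingHom.coe_comp,
        Function.comp_apply, AlgHom.toRingHom_eq_coe, AlgHom.coe_toRingHom, linSubst_X,
        map_sum, map_mul]
      rw [← Finset.sum_add_distrib]
      refine Finset.sum_congr rfl fun t _ => ?_
      ring
  exact RingHom.congr_fun key P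

/-- The coefficient of `Y'^I` in `∏_s (Σ_t c_{st} Y'_t)^{I'_s}` (over `R[X']`) is the constant
`γ_c(I', I)`. [folklore] -/
theorem coeff_prod_sum_pow (c : σ → τ → R) (I' : σ →₀ ℕ) (I : τ →₀ ℕ) :
    coeff I (∏ s, (∑ t, C (C (c s t)) * X t : MvPolynomial τ (MvPolynomial τ R)) ^ (I' s)) =
      C (substCoeff c I' I) := by
  have hmap : (∏ s, (∑ t, C (C (c s t)) * X t : MvPolynomial τ (MvPolynomial τ R)) ^ (I' s)) =
      MvPolynomial.map (C : R →+* MvPolynomial τ R)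
        (∏ s, (∑ t, C (c s t) * X t : MvPolynomial τ R) ^ (I' s)) := by
    simp [map_prod, map_pow, map_sum]
  rw [hmap, coeff_map, substCoeff]

variable [DecidableEq σ] [DecidableEq τ]

/-- **Chain rule for `∂_I` under a linear substitution** (B–G 7.5.14, 7.5.23): for any finite
set `T` of multi-indices containing all `I'` with `∂_{I'} P ≠ 0`,
`∂_I (P ∘ c) = Σ_{I' ∈ T} (∂_{I'} P ∘ c) · γ_c(I', I)`. [cite: BombieriGubler2006, 7.5.23] -/
theorem hasseD_linSubst (c : σ → τ → R) (P : MvPolynomial σ R) (I : τ →₀ ℕ)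
    {T : Finset (σ →₀ ℕ)} (hT : ∀ I', hasseD I' P ≠ 0 → I' ∈ T) :
    hasseD I (linSubst c P) = ∑ I' ∈ T, linSubst c (hasseD I' P) * C (substCoeff c I' I) := by
  rw [hasseD_eq_taylorCoeff, Taylor.taylorCoeff, ← shiftSubst_shift]
  -- expand `shift P = Σ_{I'} monomial I' (taylorCoeff I' P)` over `T`
  have hexp : Taylor.shift P = ∑ I' ∈ T, monomial I' (hasseD I' P) := by
    rw [(Taylor.shift P).as_sum]
    apply Finset.sum_subset_zero_on_sdiff
    · intro I' hI'
      exact hT I' ((mem_support_shift P I').mp hI')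
    · intro I' hI'
      rw [Finset.mem_sdiff] at hI'
      have h0 : hasseD I' P = 0 := by
        by_contra h0
        exact hI'.2 ((mem_support_shift P I').mpr h0)
      rw [h0, map_zero]
    · intro I' _
      rw [hasseD_eq_taylorCoeff, Taylor.taylorCoeff]
  rw [hexp, map_sum, coeff_sum]
  refine Finset.sum_congr rfl fun I' _ => ?_
  rw [shiftSubst, eval₂Hom_monomial, RingHom.coe_comp, Function.comp_apply, coeff_C_mul,
    Finsupp.prod_fintype _ _ (fun s => pow_zero _), coeff_prod_sum_pow]
  rfl

end ChainRule

/-! ### Weights: `γ_c(I', I) = 0` unless the weights agree -/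

section Weights

variable {M : Type*} [AddCommMonoid M]

/-- A linear form all of whose variables have weight `m` is weighted homogeneous of weight `m`.
[folklore] -/
theorem isWeightedHomogeneous_sum_C_mul_X [Fintype τ] (w : τ → M) (a : τ → R) (m : M)
    (h : ∀ t, a t ≠ 0 → w t = m) :
    IsWeightedHomogeneous w (∑ t, C (a t) * X t : MvPolynomial τ R) m := by
  refine IsWeightedHomogeneous.sum _ _ _ fun t _ => ?_
  by_cases ht : a t = 0
  · rw [ht, C_0, zero_mul]; exact isWeightedHomogeneous_zero _ _ _
  · rw [← h t ht]
    exact (isWeightedHomogeneous_X _ _ _).C_mul _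

variable [Fintype σ] [Fintype τ]

/-- For a weight-preserving substitution (`c_{st} ≠ 0 ⇒ w'(t) = w(s)`), the polynomial
`∏_s (Σ_t c_{st} X_t)^{I'_s}` is weighted homogeneous of weight `weight_w(I')`. [folklore] -/
theorem isWeightedHomogeneous_prod_sum_pow (c : σ → τ → R) (w : σ → M) (w' : τ → M)
    (hc : ∀ s t, c s t ≠ 0 → w' t = w s) (I' : σ →₀ ℕ) :
    IsWeightedHomogeneous w' (∏ s, (∑ t, C (c s t) * X t : MvPolynomial τ R) ^ (I' s))
      (Finsupp.weight w I') := by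
  have hw : Finsupp.weight w I' = ∑ s, I' s • w s := by
    rw [Finsupp.weight_apply, Finsupp.sum_fintype I' (fun i c => c • w i) (fun i => zero_smul ℕ _)]
  rw [hw]
  refine IsWeightedHomogeneous.prod _ _ _ fun s _ => ?_
  exact (isWeightedHomogeneous_sum_C_mul_X w' (c s) (w s) (hc s)).pow _

/-- **Weight selection rule**: for a weight-preserving substitution, `γ_c(I', I) = 0` unless
`weight_{w'}(I) = weight_w(I')`; for the block weight this is B–G's remark that `a(L; J; I)`
involves only `J` with `|j_h| = d_h - |i_h|`. [cite: BombieriGubler2006, 7.5.14] -/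
theorem substCoeff_eq_zero_of_weight_ne (c : σ → τ → R) (w : σ → M) (w' : τ → M)
    (hc : ∀ s t, c s t ≠ 0 → w' t = w s) (I' : σ →₀ ℕ) (I : τ →₀ ℕ)
    (hne : Finsupp.weight w' I ≠ Finsupp.weight w I') : substCoeff c I' I = 0 :=
  (isWeightedHomogeneous_prod_sum_pow c w w' hc I').coeff_eq_zero I hne

/-- **Weighted homogeneity is preserved by weight-preserving substitutions.** [folklore] -/
theorem IsWeightedHomogeneous.linSubst {c : σ → τ → R} {w : σ → M} {w' : τ → M}
    (hc : ∀ s t, c s t ≠ 0 → w' t = w s) {P : MvPolynomial σ R} {m : M}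
    (hP : IsWeightedHomogeneous w P m) : IsWeightedHomogeneous w' (linSubst c P) m := by
  classical
  rw [P.as_sum, map_sum]
  refine IsWeightedHomogeneous.sum _ _ _ fun k hk => ?_
  have hwk : Finsupp.weight w k = m := hP (mem_support_iff.mp hk)
  rw [linSubst_monomial, ← hwk]
  exact (isWeightedHomogeneous_prod_sum_pow c w w' hc k).C_mul _

end Weights

section WeightsD

variable {M : Type*} [AddCommMonoid M]

/-- **`∂_I` shifts weights**: every monomial `X^k` of `∂_I P` has `weight(k) + weight(I) = m`
when `P` is weighted homogeneous of weight `m`. [folklore] -/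
theorem weight_add_weight_of_coeff_hasseD_ne_zero {w : τ → M} {P : MvPolynomial τ R} {m : M}
    (hP : IsWeightedHomogeneous w P m) (I k : τ →₀ ℕ) (hk : coeff k (hasseD I P) ≠ 0) :
    Finsupp.weight w k + Finsupp.weight w I = m := by
  rw [coeff_hasseD] at hk
  have h : coeff (k + I) P ≠ 0 := fun h0 => hk (by rw [h0, mul_zero])
  rw [← map_add]
  exact hP h

/-- `∂_I P` is weighted homogeneous of weight `m'` whenever `P` is of weight `m' + weight(I)`
(for a cancellative weight monoid). [folklore] -/
theorem isWeightedHomogeneous_hasseD {M' : Type*} [AddCommMonoid M'] [IsCancelAdd M']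
    {w : τ → M'} {P : MvPolynomial τ R} {m' : M'}
    (I : τ →₀ ℕ) (hP : IsWeightedHomogeneous w P (m' + Finsupp.weight w I)) :
    IsWeightedHomogeneous w (hasseD I P) m' := by
  intro k hk
  have h := weight_add_weight_of_coeff_hasseD_ne_zero hP I k hk
  exact add_right_cancel h

end WeightsD

/-! ### Blocks: `m` blocks of `N` variables (B–G 7.5.14) -/

section Blocks

variable {m N : ℕ}

/-- The block weight: the variable `x_{h,i}` has weight `e_h ∈ ℕ^m`; a polynomial is
multihomogeneous of multidegree `d` iff it is weighted homogeneous of weight `d` for this weight.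
[cite: BombieriGubler2006, 7.5.14] -/
def blockW (m N : ℕ) : Fin m × Fin N → (Fin m → ℕ) := fun s => Pi.single s.1 1

/-- The block degrees `(|k_1|, …, |k_m|)` of a multi-index are its block weight.
[cite: BombieriGubler2006, 7.5.14] -/
theorem weight_blockW_apply (k : Fin m × Fin N →₀ ℕ) (h : Fin m) :
    Finsupp.weight (blockW m N) k h = ∑ i, k (h, i) := by
  rw [Finsupp.weight_apply,
    Finsupp.sum_fintype k (fun i c => c • blockW m N i) (fun i => zero_smul ℕ _)]
  rw [Finset.sum_apply, Fintype.sum_prod_type]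
  simp only [blockW, Pi.smul_apply, Pi.single_apply, smul_eq_mul, mul_ite, mul_one, mul_zero]
  rw [Finset.sum_comm]
  simp

/-- A block-diagonal substitution `x_{h,i} ↦ Σ_k B_h(i,k) x_{h,k}`.
[cite: BombieriGubler2006, 7.5.14] -/
def blockDiag (B : Fin m → Fin N → Fin N → R) : Fin m × Fin N → Fin m × Fin N → R :=
  fun s t => if s.1 = t.1 then B s.1 s.2 t.2 else 0

/-- Block-diagonal substitutions preserve the block weight. [folklore] -/
theorem blockDiag_weight (B : Fin m → Fin N → Fin N → R) :
    ∀ s t, blockDiag B s t ≠ 0 → blockW m N t = blockW m N s := by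
  intro s t h
  unfold blockDiag at h
  by_cases hst : s.1 = t.1
  · simp [blockW, hst]
  · simp [hst] at h

/-- For a block-diagonal substitution, `γ(I', I) = 0` unless `I` and `I'` have the same block
degrees. [cite: BombieriGubler2006, 7.5.14] -/
theorem substCoeff_blockDiag_eq_zero (B : Fin m → Fin N → Fin N → R) (I' I : Fin m × Fin N →₀ ℕ)
    (hne : Finsupp.weight (blockW m N) I ≠ Finsupp.weight (blockW m N) I') :
    substCoeff (blockDiag B) I' I = 0 :=
  substCoeff_eq_zero_of_weight_ne _ _ _ (blockDiag_weight B) I' I hne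

/-- The value of a block-diagonal substitution on a variable: `x_{h,i} ↦ Σ_k B_h(i,k) x_{h,k}`.
[folklore] -/
theorem linSubst_blockDiag_X (B : Fin m → Fin N → Fin N → R) (h : Fin m) (i : Fin N) :
    linSubst (blockDiag B) (X (h, i)) = ∑ k, C (B h i k) * X (h, k) := by
  rw [linSubst_X, Fintype.sum_prod_type]
  rw [Finset.sum_eq_single h]
  · simp [blockDiag]
  · intro h' _ hh'
    simp [blockDiag, Ne.symm hh']
  · simp

end Blocks

end Literature.NumberTheory.DiophantineApproximation.Subspace
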